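import Summits.QuantumFields.BalabanUV.Beta.FP.HorizontalEnd

/-!
# `BalabanUV.Beta.FP.HorizontalEndNat` — road «FP» for binder row D1, row N7/H4: THE END `hasym ⟸ hbook ∧ hgerm` WITH AN INTEGER WINDOW ARGUMENT
# (the shape in which rows H3-BOOK (`FP/HorizontalBookkeepingEnd`/`…Letters`, window `Σ_{0<‖z‖∞≤N}`, `N : ℕ`) and H2-c (`FP/HorizontalGerm`, `M : ℕ`) deliver)

HONEST DEPENDENCY (page 1, mandatory): continuum YM on T⁴ ⇐ BetaPertH ∧ nine spine estimates (0/9 proved); BetaPertH ⇐ (D1) ∧ (D4) ∧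
CAP+tail; G-an2-4 gates asym, D1 and NE2/3/4.  HONEST FRAMING (cell contract, verbatim): «discharging `BetaPertH` makes Bałaban's UV
stability UNCONDITIONAL — a real constructive-QFT result; it is NOT the continuum limit and NOT the Clay problem.»  THIS MODULE is a ten-line
[folklore] triangle inequality, the `ℕ`-window twin of the road owner's `FP/HorizontalEnd.hasym_of_horizontal` (`g : ℝ → ℝ` there, `g : ℕ → ℝ` here, so
that no floor ∕ cast adapter is needed between H3-BOOK's `N : ℕ` window and H4); no `def`, no cite, 0 `sorry`.  NOT hasym-discharged (its two hypotheses
are the rows H3-BOOK-instance and H2-c), NOT D1, NOT BetaPertH, NOT continuum, NOT Clay.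

ABSOLUTE RULE (cell charter, verbatim): «No internally-minted statement may enter as a cited fact. Every hypothesis is either kernel-proved in this
package or a verbatim quotation of a PUBLISHED theorem with page reference. The manuscript(s) under audit are NOT citable for their own disputed
steps — they are the thing under adjudication; programme-internal (2001/route/tribunal) claims are never citable.»
Provenance: D1 formalisation swarm, unit b2b-balaban-beta-d1-formalise-leaf-05 gen 8 (prover-b2b-balaban-beta-d1-formalise-leaf-05-g8-0), 2026-08-20.
-/

namespace Summit.QuantumFields.BalabanUV.Beta.FP.HorizontalEndNat

/-- [folklore] **`hasym ⟸ hbook ∧ hgerm`, INTEGER WINDOW**: if `|f m − g (L^m)| ≤ U` for `m ≥ 1` and `|g M − (s·log M + c₀)| ≤ C` for `M ≥ 1`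
(`g : ℕ → ℝ`, `L ≥ 1`), then `|f m − m·(s·log L)| ≤ U + C + |c₀|` for every `m ≥ 1`. -/
theorem hasym_of_horizontal_nat {f g : ℕ → ℝ} {s U c₀ C : ℝ} {L : ℕ} (hL : 1 ≤ L)
    (hbook : ∀ m : ℕ, 1 ≤ m → |f m - g (L ^ m)| ≤ U)
    (hgerm : ∀ M : ℕ, 1 ≤ M → |g M - (s * Real.log M + c₀)| ≤ C) :
    ∀ m : ℕ, 1 ≤ m → |f m - (m : ℝ) * (s * Real.log L)| ≤ U + C + |c₀| := by
  intro m hm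
  have h1 := hbook m hm
  have h2 := hgerm (L ^ m) (Nat.one_le_pow _ _ hL)
  have hlog : Real.log ((L ^ m : ℕ) : ℝ) = (m : ℝ) * Real.log L := by
    push_cast
    rw [Real.log_pow]
  rw [hlog] at h2
  have e : f m - (m : ℝ) * (s * Real.log L)
      = (f m - g (L ^ m)) + (g (L ^ m) - (s * ((m : ℝ) * Real.log L) + c₀)) + c₀ := by ring
  rw [e]
  calc |f m - g (L ^ m) + (g (L ^ m) - (s * ((m : ℝ) * Real.log L) + c₀)) + c₀|
      ≤ |f m - g (L ^ m) + (g (L ^ m) - (s * ((m : ℝ) * Real.log L) + c₀))| + |c₀| := abs_add_le _ _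
    _ ≤ |f m - g (L ^ m)| + |g (L ^ m) - (s * ((m : ℝ) * Real.log L) + c₀)| + |c₀| := by
        have := abs_add_le (f m - g (L ^ m)) (g (L ^ m) - (s * ((m : ℝ) * Real.log L) + c₀))
        linarith
    _ ≤ U + C + |c₀| := by linarith

/-- [folklore] The real-window END follows from the integer-window one by restriction (`g R := gℝ R` sampled at `R = L^m ∈ ℕ`): a convenience
restatement showing the two shapes agree on the road's data. -/
theorem hasym_of_horizontal_real_of_nat {f : ℕ → ℝ} {g : ℝ → ℝ} {s U c₀ C : ℝ} {L : ℕ} (hL : 1 ≤ L)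
    (hbook : ∀ m : ℕ, 1 ≤ m → |f m - g ((L : ℝ) ^ m)| ≤ U)
    (hgerm : ∀ M : ℕ, 1 ≤ M → |g M - (s * Real.log M + c₀)| ≤ C) :
    ∀ m : ℕ, 1 ≤ m → |f m - (m : ℝ) * (s * Real.log L)| ≤ U + C + |c₀| := by
  refine hasym_of_horizontal_nat (g := fun M : ℕ => g M) hL (fun m hm => ?_) hgerm
  have := hbook m hm
  push_cast
  exact this

end Summit.QuantumFields.BalabanUV.Beta.FP.HorizontalEndNat
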